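import Literature.Algebra.Lie.LefschetzModuleHorizontalSubalgebra
import HarnessLib

/-!
# Looijenga–Lunts (5.3): "`a` has the Lefschetz property in `Gr_hor M`" ⟺ the lowest horizontal component `a_2` is a Lefschetz operator of `(M, h_hor)`

Topic `Literature/Algebra/Lie` (namespace `Literature.Algebra.Lie`).  Lane `lit-hodgefound` (Track 2 foundations
library), skeleton seat `lit-hodgefound-skel-1` (generation 47), row **A1-151** of
`run/shared/lean/pub/lit-hodgefound/SKELETON.md`.  Companion of A1-149 (`LefschetzModuleHorizontalSubalgebra.lean`),
whose SCOPE (a) records that `Gr_hor M` is MODELLED by `(M, h_hor)` and that the printed hypothesis "`Gr_hor M` is a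
Lefschetz module of `𝔞_hor`" enters through the model clause `HasLefschetzProperty H a_2`.  This file proves that the
model clause IS the printed one: for `a` raising the horizontal filtration by `2`, "`a` has the Lefschetz property in
`Gr_hor M`" — in the tree's lattice rendering `IsMonodromyWeightFiltration a 0 (i ↦ hor^{-i} M)` of
"`a hor^k ⊆ hor^{k+2}`, `a^k : Gr^{-k}_hor M ⥲ Gr^k_hor M`", the form used for every Lefschetz-on-graded-pieces
statement of the tree (its clauses are exactly injectivity and surjectivity on the quotients,
`IsMonodromyWeightFiltration.bijective_grPowMap`) — holds if and only if `a_2 = gr(a)` has the Lefschetz property on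
`M` graded by `h_hor`.  THEOREMS ONLY (no definition, no named fact, no `sorry`; D-0026 net debt `0`); the commutator
Lie ring on `𝔤𝔩(M)` is Mathlib's reducible non-instance `LieRing.ofAssociativeRing`, enabled FILE-LOCALLY as in the
whole series (needed to name `ad h_hor` and `𝔤(𝔞_{2,0}, M_hor)`).

## Source, VERBATIM

E. Looijenga, V. A. Lunts, *A Lie algebra attached to a projective variety*, Invent. Math. **129** (1997) 361–412
(held TeX text `paper:arxiv-alg-geom_9604014`), §5:

> (5.1) p0020 L99–L106: "If `e` is a nilpotent transformation in a vector space `M`, then there is a unique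
> nonincreasing filtration `W^•` preserved by `e` such that `e` has the Lefschetz property in `Gr^•_W(M)`. Any
> `𝔰𝔩₂`-triple `(e, h, f)` containing `e` descends to an `𝔰𝔩₂`-triple in `Gr_W(M)` and splits the filtration (so the
> `k`-eigen space of `h` is a supplement of `W^{k+1}` in `W^k`). We shall refer to `W^•` as the Lefschetz filtration
> of `e`."
> (5.3) p0021 L11–L17: "Suppose now that some `a ∈ 𝔞` preserves the vertical grading (i.e., `e_a(hor^k M) ⊂
> hor^{k+2} M` for all `k`) and has the Lefschetz property in `Gr_hor M`: `e_a^k` sends `Gr^{-k}_hor M` isomorphically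
> onto `Gr^k_hor M`. It is then immediate that the horizontal filtration is the Lefschetz filtration of the
> transformation `e_a` in `M`."
> (5.3) Proposition, p0021 L32–L41: "Let `𝔞_hor ⊂ 𝔞` be the set of `a ∈ 𝔞` that preserve the vertical grading and
> suppose that `Gr_hor M` is a Lefschetz module of `𝔞_hor`. Then […] The span of the components of `𝔞_hor` of lowest
> horizontal degree `2` make up an abelian subalgebra `𝔞_{2,0}` of `𝔤(𝔞, M)_{2,0}` that has the Lefschetz property in
> `M` with respect to the horizontal grading."

## Contents (all proved; `K` a field of characteristic `0`, `M` finite-dimensional, `H` `ℤ`-diagonalisable)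

* `exists_horFiltration_eq_top` / `exists_horFiltration_eq_bot` (the horizontal filtration `hor^k M = ⊕_{j ≥ k} M_j(H)`
  is finite), `pow_apply_mem_horFiltration` (`a^n hor^k ⊆ hor^{k+2n}`),
  **`pow_apply_sub_pow_degreeComponent_apply_mem`** (`gr(a^n) = a_2^n`: `a^n x ≡ a_2^n x mod hor^{k+2n+1}` on `M_k(H)`),
  `eq_zero_of_mem_degreeSpace_of_mem_horFiltration` (`M_k(H) ∩ hor^{k'} M = 0`, `k < k'`).
* **`isMonodromyWeightFiltration_horFiltration_iff_hasLefschetzProperty`** — for `a ∈ ⊕_{j ≥ 2} 𝔤𝔩(M)_j(ad H)`: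
  `IsMonodromyWeightFiltration a 0 (i ↦ hor^{-i} M) ↔ HasLefschetzProperty H a_2`.  (`→`: injectivity /
  surjectivity of `a_2^n : M_{-n} → M_n` from the lattice clauses through the splitting `hor^k = M_k(H) ⊕ hor^{k+1}`
  and `gr(a^n) = a_2^n`; `←`: the clauses from the Lefschetz bijections of `a_2`.)
* **`IsLefschetzModule.isLefschetzModule_horizontalTwoZero_of_isMonodromyWeightFiltration`** — A1-149's
  `(𝔞_{2,0}, M_hor)` is a Lefschetz module under the PRINTED form of the hypothesis on the Lefschetz element.

## SCOPE

(a) `Gr_hor M` itself is still not built as a quotient object (the lattice clauses of `IsMonodromyWeightFiltration`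
stand for bijectivity on the quotients, as everywhere in the tree); the semisimplicity clause of "`Gr_hor M` is a
Lefschetz module of `𝔞_hor`" stays in model form (`𝔤(𝔞_{2,0}, M_hor)` semisimple), see A1-149 SCOPE (a).
(b) Nothing here concerns complex tori or the Hodge conjecture.

## References

* [LooijengaLunts1997] E. Looijenga, V. A. Lunts, *A Lie algebra attached to a projective variety*, Invent. Math. 129
  (1997) 361–412; arXiv:alg-geom/9604014. §5 (5.1) p. 20 L99–L106, (5.3) p. 21 L11–L17, Proposition L32–L41 of the
  held TeX text.
* [CattaniElZeinGriffithsLe2014] E. Cattani et al. (eds.), *Hodge Theory*, Math. Notes 49, App. A Prop. A.2.2 — via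
  the tree's `MonodromyWeightFiltration.lean` (`IsMonodromyWeightFiltration`, `bijective_grPowMap`).
-/

namespace Literature.Algebra.Lie

open Module Function Set LieAlgebra

attribute [local instance 100] LieRing.ofAssociativeRing

section GrLefschetz

variable {K : Type*} [Field K] [CharZero K] {M : Type*} [AddCommGroup M] [Module K M] [FiniteDimensional K M]
  {H : Module.End K M}

/-- The horizontal filtration is exhaustive below: `hor^k M = M` for `k` below every weight of `H` (`M = ⊕_k M_k(H)` has
finitely many weights). [cite: LooijengaLunts1997, §5 (5.1) p. 20 L99–L102 ("a unique nonincreasing filtration")] -/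
theorem exists_horFiltration_eq_top (hH : IsZGrading H) : ∃ k : ℤ, ⨆ (j : ℤ) (_ : k ≤ j), degreeSpace H j = ⊤ := by
  obtain ⟨k, hk⟩ := (finite_setOf_degreeSpace_ne_bot H).bddBelow
  refine ⟨k, ?_⟩
  rw [eq_top_iff, ← (show ⨆ j : ℤ, degreeSpace H j = ⊤ from hH)]
  refine iSup_le fun j ↦ ?_
  by_cases hj : degreeSpace H j = ⊥
  · rw [hj]; exact bot_le
  · exact le_iSup₂_of_le j (hk hj) le_rfl

omit [CharZero K] [FiniteDimensional K M] in
/-- … and separated above: `hor^k M = 0` for `k` above every weight of `H`. [cite: LooijengaLunts1997, §5 (5.1) p. 20 L99–L102] -/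
theorem exists_horFiltration_eq_bot [CharZero K] [FiniteDimensional K M] (H : Module.End K M) :
    ∃ k : ℤ, ⨆ (j : ℤ) (_ : k ≤ j), degreeSpace H j = ⊥ := by
  obtain ⟨k, hk⟩ := (finite_setOf_degreeSpace_ne_bot H).bddAbove
  refine ⟨k + 1, ?_⟩
  rw [eq_bot_iff]
  refine iSup₂_le fun j hj ↦ ?_
  by_cases hj' : degreeSpace H j = ⊥
  · rw [hj']
  · exact absurd (hk hj') (by omega)

omit [CharZero K] [FiniteDimensional K M] in
/-- Powers of an operator raising the horizontal filtration by `2` raise it by `2n`: `a^n (hor^k M) ⊆ hor^{k+2n} M`.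
[cite: LooijengaLunts1997, §5 (5.3) p. 21 L13–L14 ("e_a^k sends Gr^{-k}_hor M … onto Gr^k_hor M")] -/
theorem pow_apply_mem_horFiltration {a : Module.End K M}
    (ha : ∀ k : ℤ, ∀ x ∈ ⨆ (j : ℤ) (_ : k ≤ j), degreeSpace H j, a x ∈ ⨆ (j : ℤ) (_ : k + 2 ≤ j), degreeSpace H j)
    (n : ℕ) {k : ℤ} {x : M} (hx : x ∈ ⨆ (j : ℤ) (_ : k ≤ j), degreeSpace H j) :
    (a ^ n) x ∈ ⨆ (j : ℤ) (_ : k + 2 * n ≤ j), degreeSpace H j := by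
  induction n with
  | zero => simpa using hx
  | succ n ih =>
    rw [pow_succ', Module.End.mul_apply]
    have h1 := ha _ _ ih
    exact horFiltration_le_of_le H (by push_cast; omega) h1

/-- **`gr(a^n) = a_2^n` on `Gr^k_hor M ≅ M_k(H)`**: for `a ∈ ⊕_{j ≥ 2} 𝔤𝔩(M)_j(ad H)` and `x ∈ M_k(H)`,
`a^n x ≡ a_2^n x (mod hor^{k+2n+1} M)` (A1-149 `apply_sub_degreeComponent_apply_mem_horFiltration` is `n = 1`).
[cite: LooijengaLunts1997, §5 (5.3) p. 21 L13–L14, L39–L43] -/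
theorem pow_apply_sub_pow_degreeComponent_apply_mem (hH : IsZGrading H) {a : Module.End K M}
    (ha : a ∈ ⨆ (j : ℤ) (_ : 2 ≤ j), adDegree K H (j : K)) (n : ℕ) {k : ℤ} {x : M} (hx : x ∈ degreeSpace H k) :
    (a ^ n) x - (degreeComponent (LieAlgebra.ad K (Module.End K M) H) 2 a ^ n) x ∈
      ⨆ (j : ℤ) (_ : k + 2 * n + 1 ≤ j), degreeSpace H j := by
  induction n with
  | zero => simp
  | succ n ih =>
    have ha' := (forall_apply_mem_horFiltration_iff hH).2 ha
    have h3 := sub_degreeComponent_mem_biSup hH ha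
    -- `a^{n+1} x - a_2^{n+1} x = a (a^n x - a_2^n x) + (a - a_2) (a_2^n x)`
    have e1 : (a ^ (n + 1)) x - (degreeComponent (LieAlgebra.ad K (Module.End K M) H) 2 a ^ (n + 1)) x =
        a ((a ^ n) x - (degreeComponent (LieAlgebra.ad K (Module.End K M) H) 2 a ^ n) x) +
          (a - degreeComponent (LieAlgebra.ad K (Module.End K M) H) 2 a)
            ((degreeComponent (LieAlgebra.ad K (Module.End K M) H) 2 a ^ n) x) := by
      rw [pow_succ', pow_succ', Module.End.mul_apply, Module.End.mul_apply, map_sub, LinearMap.sub_apply]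
      abel
    rw [e1]
    refine Submodule.add_mem _ ?_ ?_
    · exact horFiltration_le_of_le H (by push_cast; omega) (ha' _ _ ih)
    · have h4 : (degreeComponent (LieAlgebra.ad K (Module.End K M) H) 2 a ^ n) x ∈ degreeSpace H (k + 2 * n) :=
        pow_apply_mem_degreeSpace (fun i y hy ↦ degreeComponent_ad_apply_mem_degreeSpace hH a 2 hy) hx n
      exact horFiltration_le_of_le H (by push_cast; omega)
        (apply_mem_horFiltration_of_mem_biSup_adDegree h3 _ (degreeSpace_le_horFiltration H _ h4))

omit [FiniteDimensional K M] in
/-- `M_k(H) ∩ hor^{k'} M = 0` for `k < k'`. [cite: LooijengaLunts1997, §5 (5.1) p. 20 L103–L105] -/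
theorem eq_zero_of_mem_degreeSpace_of_mem_horFiltration {k k' : ℤ} (hkk' : k < k') {x : M}
    (hx : x ∈ degreeSpace H k) (hx' : x ∈ ⨆ (j : ℤ) (_ : k' ≤ j), degreeSpace H j) : x = 0 := by
  have h1 := (disjoint_degreeSpace_horFiltration (H := H) k).le_bot
    (Submodule.mem_inf.2 ⟨hx, horFiltration_le_of_le H (show k + 1 ≤ k' by omega) hx'⟩)
  rwa [Submodule.mem_bot] at h1

/-- **"`a` has the Lefschetz property in `Gr_hor M`" ⟺ `a_2` is a Lefschetz operator of `(M, h_hor)`.**  Printed: "some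
`a ∈ 𝔞` preserves the vertical grading … and has the Lefschetz property in `Gr_hor M`: `e_a^k` sends `Gr^{-k}_hor M`
isomorphically onto `Gr^k_hor M`. It is then immediate that the horizontal filtration is the Lefschetz filtration of
the transformation `e_a` in `M`."  For `a` raising `hor^• M = ⊕_{j ≥ •} M_j(H)` by `2` (`a ∈ ⊕_{j ≥ 2} 𝔤𝔩(M)_j(ad H)`),
the statement "`a hor^k ⊆ hor^{k+2}` and `a^k : Gr^{-k}_hor ⥲ Gr^k_hor` for all `k ≥ 0`" — rendered, as throughout the
tree, by `IsMonodromyWeightFiltration a 0 (i ↦ hor^{-i} M)` (its lattice clauses ARE injectivity and surjectivity on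
the graded quotients, the tree's `IsMonodromyWeightFiltration.bijective_grPowMap`) — holds if and only if the
lowest horizontal component `a_2 = gr(a)` (`pow_apply_sub_pow_degreeComponent_apply_mem`) has the Lefschetz property
on `M` graded by `H` (A1-88 `HasLefschetzProperty H a_2`).  This identifies the printed hypothesis on `Gr_hor M` with
the model hypothesis used in A1-149 `isLefschetzModule_horizontalTwoZero`. [cite: LooijengaLunts1997, §5 (5.3) p. 21 L11–L17, L39–L41; (5.1) p. 20 L99–L106] [cite: CattaniElZeinGriffithsLe2014, App. A Prop. A.2.2] -/
theorem isMonodromyWeightFiltration_horFiltration_iff_hasLefschetzProperty (hH : IsZGrading H) {a : Module.End K M}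
    (ha : a ∈ ⨆ (j : ℤ) (_ : 2 ≤ j), adDegree K H (j : K)) :
    Literature.AlgebraicGeometry.HodgeTheory.IsMonodromyWeightFiltration a 0
        (fun i ↦ ⨆ (j : ℤ) (_ : -i ≤ j), degreeSpace H j) ↔
      HasLefschetzProperty H (degreeComponent (LieAlgebra.ad K (Module.End K M) H) 2 a) := by
  have ha' := (forall_apply_mem_horFiltration_iff hH).2 ha
  have hmaps : ∀ k : ℤ, MapsTo (degreeComponent (LieAlgebra.ad K (Module.End K M) H) 2 a) (degreeSpace H k)
      (degreeSpace H (k + 2)) := fun k x hx ↦ degreeComponent_ad_apply_mem_degreeSpace hH a 2 hx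
  -- abbreviation-free names for the two operators
  have hpow : ∀ (n : ℕ) {k : ℤ} {x : M}, x ∈ degreeSpace H k →
      (degreeComponent (LieAlgebra.ad K (Module.End K M) H) 2 a ^ n) x ∈ degreeSpace H (k + 2 * n) :=
    fun n k x hx ↦ pow_apply_mem_degreeSpace hmaps hx n
  constructor
  · intro hW
    refine ⟨hmaps, fun n ↦ ⟨fun x hx ↦ ?_, fun x₀ hx₀ x₁ hx₁ hxx ↦ ?_, fun y₀ hy₀ ↦ ?_⟩⟩
    · -- maps to
      have h1 := hpow n hx
      rwa [show -(n : ℤ) + 2 * n = n by ring] at h1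
    · -- injective on `M_{-n}`: `d = x₀ - x₁` has `a_2^n d = 0`, so `a^n d ∈ hor^{n+1}`, so `d ∈ hor^{-n+1} ∩ M_{-n} = 0`
      rw [← sub_eq_zero]
      have hd : x₀ - x₁ ∈ degreeSpace H (-(n : ℤ)) := Submodule.sub_mem _ hx₀ hx₁
      have hd0 : (degreeComponent (LieAlgebra.ad K (Module.End K M) H) 2 a ^ n) (x₀ - x₁) = 0 := by
        rw [map_sub, sub_eq_zero]; exact hxx
      have h2 := pow_apply_sub_pow_degreeComponent_apply_mem hH ha n hd
      rw [hd0, sub_zero] at h2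
      have h3 : x₀ - x₁ ∈ (⨆ (j : ℤ) (_ : -((0 : ℤ) + n) ≤ j), degreeSpace H j) ⊓
          (⨆ (j : ℤ) (_ : -((0 : ℤ) - n - 1) ≤ j), degreeSpace H j).comap (a ^ n) := by
        refine Submodule.mem_inf.2 ⟨horFiltration_le_of_le H (by omega) (degreeSpace_le_horFiltration H _ hd), ?_⟩
        rw [Submodule.mem_comap]
        exact horFiltration_le_of_le H (by omega) h2
      have h4 := hW.inf_comap_le n h3
      exact eq_zero_of_mem_degreeSpace_of_mem_horFiltration (show -(n : ℤ) < -((0 : ℤ) + n - 1) by omega) hd h4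
    · -- surjective onto `M_n`
      have hy : y₀ ∈ ⨆ (j : ℤ) (_ : -((0 : ℤ) - n) ≤ j), degreeSpace H j :=
        horFiltration_le_of_le H (by omega) (degreeSpace_le_horFiltration H _ hy₀)
      obtain ⟨z, hz, r, hr, hzr⟩ := Submodule.mem_sup.1 (hW.le_map_sup n hy)
      obtain ⟨x, hx, rfl⟩ := Submodule.mem_map.1 hz
      -- `x = x₀ + x'`, `x₀ ∈ M_{-n}`, `x' ∈ hor^{-n+1}`
      have hx' : x ∈ ⨆ (j : ℤ) (_ : -(n : ℤ) ≤ j), degreeSpace H j := horFiltration_le_of_le H (by omega) hx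
      rw [horFiltration_eq_sup] at hx'
      obtain ⟨x₀, hx₀, x', hx'', rfl⟩ := Submodule.mem_sup.1 hx'
      refine ⟨x₀, hx₀, ?_⟩
      -- `y₀ - a_2^n x₀ ∈ M_n ∩ hor^{n+1} = 0`
      have h5 : y₀ - (degreeComponent (LieAlgebra.ad K (Module.End K M) H) 2 a ^ n) x₀ ∈
          ⨆ (j : ℤ) (_ : (n : ℤ) + 1 ≤ j), degreeSpace H j := by
        have e1 : y₀ - (degreeComponent (LieAlgebra.ad K (Module.End K M) H) 2 a ^ n) x₀ =
            ((a ^ n) x₀ - (degreeComponent (LieAlgebra.ad K (Module.End K M) H) 2 a ^ n) x₀) + (a ^ n) x' + r := by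
          rw [← hzr, map_add]; abel
        rw [e1]
        refine Submodule.add_mem _ (Submodule.add_mem _ ?_ ?_) ?_
        · exact horFiltration_le_of_le H (by omega) (pow_apply_sub_pow_degreeComponent_apply_mem hH ha n hx₀)
        · exact horFiltration_le_of_le H (by omega) (pow_apply_mem_horFiltration ha' n hx'')
        · exact horFiltration_le_of_le H (by omega) hr
      have h6 : y₀ - (degreeComponent (LieAlgebra.ad K (Module.End K M) H) 2 a ^ n) x₀ ∈ degreeSpace H n := by
        refine Submodule.sub_mem _ hy₀ ?_
        have h1 := hpow n hx₀
        rwa [show -(n : ℤ) + 2 * n = n by ring] at h1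
      have h7 := eq_zero_of_mem_degreeSpace_of_mem_horFiltration (show (n : ℤ) < n + 1 by omega) h6 h5
      rw [sub_eq_zero] at h7
      exact h7.symm
  · intro L
    obtain ⟨kt, hkt⟩ := exists_horFiltration_eq_top hH
    obtain ⟨kb, hkb⟩ := exists_horFiltration_eq_bot H
    refine { monotone := fun i i' hii' ↦ horFiltration_le_of_le H (by omega),
             exists_eq_bot := ⟨-kb, by rw [neg_neg]; exact hkb⟩,
             exists_eq_top := ⟨-kt, by rw [neg_neg]; exact hkt⟩,
             map_le := fun i ↦ ?_, inf_comap_le := fun n ↦ ?_, le_map_sup := fun n ↦ ?_ }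
    · rw [Submodule.map_le_iff_le_comap]
      intro x hx
      rw [Submodule.mem_comap]
      exact horFiltration_le_of_le H (by omega) (ha' _ _ hx)
    · -- injectivity on `Gr`: `x ∈ hor^{-n}`, `a^n x ∈ hor^{n+1}` ⟹ `x ∈ hor^{-n+1}`
      intro x hx
      obtain ⟨hx1, hx2⟩ := Submodule.mem_inf.1 hx
      rw [Submodule.mem_comap] at hx2
      have hx1' : x ∈ ⨆ (j : ℤ) (_ : -(n : ℤ) ≤ j), degreeSpace H j := horFiltration_le_of_le H (by omega) hx1
      rw [horFiltration_eq_sup] at hx1'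
      obtain ⟨x₀, hx₀, x', hx', rfl⟩ := Submodule.mem_sup.1 hx1'
      -- `a_2^n x₀ ∈ M_n ∩ hor^{n+1} = 0`, so `x₀ = 0`
      have h1 : (degreeComponent (LieAlgebra.ad K (Module.End K M) H) 2 a ^ n) x₀ ∈
          ⨆ (j : ℤ) (_ : (n : ℤ) + 1 ≤ j), degreeSpace H j := by
        have e1 : (degreeComponent (LieAlgebra.ad K (Module.End K M) H) 2 a ^ n) x₀ =
            (a ^ n) (x₀ + x') - (a ^ n) x' -
              ((a ^ n) x₀ - (degreeComponent (LieAlgebra.ad K (Module.End K M) H) 2 a ^ n) x₀) := by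
          rw [map_add]; abel
        rw [e1]
        refine Submodule.sub_mem _ (Submodule.sub_mem _ ?_ ?_) ?_
        · exact horFiltration_le_of_le H (by omega) hx2
        · exact horFiltration_le_of_le H (by omega) (pow_apply_mem_horFiltration ha' n hx')
        · exact horFiltration_le_of_le H (by omega) (pow_apply_sub_pow_degreeComponent_apply_mem hH ha n hx₀)
      have h2 : (degreeComponent (LieAlgebra.ad K (Module.End K M) H) 2 a ^ n) x₀ ∈ degreeSpace H n := by
        have h3 := hpow n hx₀
        rwa [show -(n : ℤ) + 2 * n = n by ring] at h3
      have h4 := eq_zero_of_mem_degreeSpace_of_mem_horFiltration (show (n : ℤ) < n + 1 by omega) h2 h1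
      have h5 : x₀ = 0 := L.eq_zero_of_pow_apply_eq_zero (n := n) (by omega) hx₀ (by rwa [Int.toNat_natCast])
      rw [h5, zero_add x']
      exact horFiltration_le_of_le H (show -((0 : ℤ) + n - 1) ≤ -(n : ℤ) + 1 by omega) hx'
    · -- surjectivity on `Gr`: `hor^n ⊆ a^n (hor^{-n}) + hor^{n+1}`
      intro y hy
      have hy' : y ∈ ⨆ (j : ℤ) (_ : (n : ℤ) ≤ j), degreeSpace H j := horFiltration_le_of_le H (by omega) hy
      rw [horFiltration_eq_sup] at hy'
      obtain ⟨y₀, hy₀, y', hy'', rfl⟩ := Submodule.mem_sup.1 hy'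
      obtain ⟨x₀, hx₀, hx₀y⟩ := (L.bijOn n).surjOn hy₀
      refine Submodule.mem_sup.2 ⟨(a ^ n) x₀, Submodule.mem_map_of_mem
        (horFiltration_le_of_le H (by omega) (degreeSpace_le_horFiltration H _ hx₀)),
        y₀ + y' - (a ^ n) x₀, ?_, by abel⟩
      have e1 : y₀ + y' - (a ^ n) x₀ =
          y' - ((a ^ n) x₀ - (degreeComponent (LieAlgebra.ad K (Module.End K M) H) 2 a ^ n) x₀) := by
        rw [← hx₀y]; abel
      rw [e1]
      refine Submodule.sub_mem _ (horFiltration_le_of_le H (by omega) hy'') ?_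
      exact horFiltration_le_of_le H (by omega) (pow_apply_sub_pow_degreeComponent_apply_mem hH ha n hx₀)

/-- **A1-149's horizontal Lefschetz module under the PRINTED hypothesis.**  "Let `𝔞_hor ⊂ 𝔞` be the set of `a ∈ 𝔞` that
preserve the vertical grading and suppose that `Gr_hor M` is a Lefschetz module of `𝔞_hor`. Then […] `𝔞_{2,0}` […]
has the Lefschetz property in `M` with respect to the horizontal grading": with the Lefschetz element of `Gr_hor M`
given in the printed form — some `a ∈ 𝔞_hor` for which `hor^• M` is the Lefschetz filtration of `a`
(`IsMonodromyWeightFiltration a 0 (i ↦ hor^{-i} M)`, i.e. `a^k : Gr^{-k}_hor ⥲ Gr^k_hor`) — and `𝔤(𝔞_{2,0}, M_hor) =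
𝔤(𝔞_hor, Gr_hor M)` semisimple, `(𝔞_{2,0}, M_hor)` is a Lefschetz module (A1-149
`IsLefschetzModule.isLefschetzModule_horizontalTwoZero` composed with the previous theorem).
[cite: LooijengaLunts1997, §5 (5.3) Proposition, p. 21 L32–L41] -/
theorem IsLefschetzModule.isLefschetzModule_horizontalTwoZero_of_isMonodromyWeightFiltration
    {h : Module.End K M} {𝔞 : Submodule K (Module.End K M)} (A : IsLefschetzModule K h 𝔞) (hH : IsZGrading H)
    (hH0 : H ≠ 0) {a : Module.End K M} (ha : a ∈ horizontalPart H 𝔞)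
    (hW : Literature.AlgebraicGeometry.HodgeTheory.IsMonodromyWeightFiltration a 0
      (fun i ↦ ⨆ (j : ℤ) (_ : -i ≤ j), degreeSpace H j))
    (hss : LieAlgebra.IsSemisimple K (lefschetzLieAlgebra K H (horizontalTwoZero H 𝔞))) :
    IsLefschetzModule K H (horizontalTwoZero H 𝔞) :=
  A.isLefschetzModule_horizontalTwoZero hH hH0 ha
    ((isMonodromyWeightFiltration_horFiltration_iff_hasLefschetzProperty hH
      ((mem_horizontalPart_iff_mem_biSup hH).1 ha).2).1 hW) hss

end GrLefschetz

end Literature.Algebra.Lie
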